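import Summits.Ventures.CertifiedManyBodySolver.Observables.StiffnessTLSeqCeiling
import Summits.Ventures.CertifiedManyBodySolver.Observables.RungLeavesStiffnessTTPrime
import Summits.Ventures.CertifiedManyBodySolver.Observables.StiffnessTLKineticCeilingURay
import Summits.Ventures.CertifiedManyBodySolver.Rows.DopedTLCorrAffine
import HarnessLib

/-!
# Ventures/CertifiedManyBodySolver — Observables/RungLeavesStiffnessAnchor.lean

HONEST FRAMING: one-sided certified CEILINGS on the uniform flux stiffness (helicity modulus / superfluid weight,
Drude-type flux curvature); not a superconductivity verdict; no stiffness floor follows from equal-time data and an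
energy window (`Observables/StiffnessNoFloor.lean`, `Literature/Barriers/HubbardSuperconductivity/StiffnessFloorInvisibleToSpectralMoments.lean`).

Cell `hubbard-obs` (D-0042), seat p2 (stiffness), `prover-hubbard-obs-p2-g9-0`. **ANCHOR-GENERIC stiffness leaves for the
burst era** — the leaf shapes of `Observables/RungLeaves.lean` (`M3ObsStiffnessCeilingAt_tp0`) and
`Observables/RungLeavesStiffnessTTPrime.lean` (`M3ObsStiffnessCeilingAt tp`) are pinned to the M3′ pair `(U, n) = (8, 7/8)`; the
burst's anchor grid is not (BURST-INPUTS-obs.md §0 item 5: ONE kinetic edge per headline anchor `(U, n, t′)`; OBS-2 windows at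
`(8, 7/8, 0)`, `(8, 7/8, −¼)`, `(8, 1, 0)`, `(4, 7/8, 0)`). This file types, for an ARBITRARY anchor `(U, n, t′)`:

* `ObsStiffnessCeilingAt tp U n c` — every uniform flux stiffness `ρ_s > 0` (scale `θ₀ > 0`, ALL even sides `L ≥ L₀`) of the
  zero-flux `(rectN n L, S^z = 0)` sectors of `hubbardTorusTT' L 1 tp U` satisfies `ρ_s ≤ c` (tree units; HVR `D_s = ρ_s/2`,
  SWZ `D/(πe²) = 2ρ_s`); `obsStiffnessCeilingAt_m3_iff` / `_m3_tp0_iff`: at `(8, 7/8)` it IS the M3 leaf;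
* `ObsStiffnessSeqCeilingAt tp U n c` — the SEQUENCE-ROBUST leaf: the same conclusion for every `ρ_s > 0` whose flux inequality
  holds along SOME sequence of sides `L_j → ∞` (not necessarily all even sides). Reading: the plain leaf bounds
  `liminf_L ρ_s(L; θ₀)`, the robust leaf bounds `limsup_L ρ_s(L; θ₀)` (`ρ_s(L; θ₀) = inf_{0<|θ|≤θ₀} (E_L(θ) − E_L(0))/θ²`), for every
  `θ₀ > 0`; equivalently (`ObsStiffnessSeqCeilingAt.le_of_frequently`) the flux inequality FREQUENTLY in `L` already forces `ρ_s ≤ c`.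
  The plain leaf can hold VACUOUSLY when open-shell sides flip the curvature sign (STIFFNESS-LINE.md §1); the robust one then
  still speaks about the closed-shell sides. `ObsStiffnessSeqCeilingAt.ceilingAt`: robust ⇒ plain;
* DISCHARGERS of the robust leaf (hence of the plain and the M3 leaves) from exactly the row shapes the cell's claim nodes
  state, at any anchor: a certified `D₄`-orbit LOWER row on `−X_λ` (odd-moment / Krylov-3 word; `λ = 0` = the `t–t′` kinetic f-sum
  word, the `kinx` nodes) plus the cap `e₀(U, n, t′) ≤ u` (`…_of_oddMomentTT_orbitLowerRow[_univ]`); a certified orbit LOWER row on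
  the kinetic word `kinWord` (`kinlo` nodes, `t′ = 0`) plus the cap (`…_tp0_of_kinWord_orbitLowerRow`); a kinetic floor `K ≤ k(ω)` on
  the torus-limit class (`…_tp0_of_kineticDensity_ge`); the AFFINE (re-priceable) rows of Rows/DopedTLCorrAffine.lean under ANY
  certified window `lo' ≤ e₀ ≤ hi'` (`…_of_affineOddMomentTT_orbitRow`, `…_tp0_of_affineKinWord_orbitRow`: the fast layer in
  leaf form, constant `−reprice …` resp. `−reprice …/4`);
* U-RAY TRANSPORT in leaf form (`t′ = 0`; hubbard-fast T-mono ∘ T6, `Observables/StiffnessTLKineticCeilingURay.lean`): ONE certified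
  kinetic ceiling / `kinWord` row at `(U₀, n, 0)` discharges `ObsStiffnessSeqCeilingAt 0 U n c` for EVERY `U ≥ U₀`
  (`…_tp0_on_ray_of_forall_negKinetic_le`, `…_tp0_on_ray_of_kinWord_orbitLowerRow`).

So a burst anchor needs ZERO new theory for its stiffness edge: claim node (row shape above) ⇒ one line ⇒ leaf. No named
fact, zero computation, no `sorry`; every discharger is CONDITIONAL on the rows / caps it names.

References: [Kohn1964]; D. J. Scalapino, S. R. White, S.-C. Zhang, PRB 47 (1993) 7995, §II [ScalapinoWhiteZhang1993];
T. Hazra, N. Verma, M. Randeria, PRX 9 (2019) 031049, eqs. (2)–(4) [HazraVermaRanderia2019]; S. Boyd, L. Vandenberghe,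
Convex Optimization (2004) §5.6 [BoydVandenberghe2004]; R. B. Griffiths, J. Math. Phys. 7 (1966) 1215 §II [Griffiths1966].
-/

noncomputable section

namespace Summit.Ventures.CertifiedManyBodySolver.Observables

open Matrix Finset Filter Topology
open Literature.MathematicalPhysics.QuantumLattice
open Literature.MathematicalPhysics.QuantumLattice.ThermodynamicLimit
open Literature.Probability.LatticeModels
open scoped ComplexOrder ComplexConjugate Topology BigOperators

/-! ## §1 The two leaf shapes at an arbitrary anchor `(U, n, t′)` -/

/-- **Stiffness ceiling `c` at the anchor `(U, n, t′)` (all-even-sides form).** Every uniform flux stiffness `ρ_s > 0`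
(scale `θ₀ > 0`, all even `L ≥ L₀`) of the zero-flux `(rectN n L, S^z = 0)` sectors of `hubbardTorusTT' L 1 tp U` — i.e. every
`ρ_s` with `ρ_s θ² ≤ fluxEnergyTT' L tp U (1 − n) θ − fluxEnergyTT' L tp U (1 − n) 0` on `|θ| ≤ θ₀` — satisfies `ρ_s ≤ c` (tree units;
Hazra–Verma–Randeria `D_s = ρ_s/2`, Scalapino–White–Zhang `D/(πe²) = 2ρ_s`). At `(8, 7/8)` this is `M3ObsStiffnessCeilingAt tp c`.
[cite: ScalapinoWhiteZhang1993, §II] -/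
def ObsStiffnessCeilingAt (tp U n : ℝ) (c : ℚ) : Prop :=
  ∀ (ρs θ₀ : ℝ), 0 < ρs → 0 < θ₀ → ∀ L₀ : ℕ,
    (∀ (L : ℕ) [NeZero L], L₀ ≤ L → Even L →
      ∀ θ : ℝ, |θ| ≤ θ₀ →
        ρs * θ ^ 2 ≤ fluxEnergyTT' L tp U (1 - n) θ - fluxEnergyTT' L tp U (1 - n) 0) →
    ρs ≤ ((c : ℚ) : ℝ)

/-- **Sequence-robust stiffness ceiling `c` at the anchor `(U, n, t′)`.** For EVERY sequence of sides `L_j → ∞` and every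
`ρ_s > 0` (scale `θ₀ > 0`) with `ρ_s θ² ≤ E_{L_j}(θ) − E_{L_j}(0)` (`|θ| ≤ θ₀`, `E_L = fluxEnergyTT' L tp U (1 − n)`) at every side of
the sequence, `ρ_s ≤ c`. Equivalently: `limsup_L inf_{0<|θ|≤θ₀} (E_L(θ) − E_L(0))/θ² ≤ c` for every `θ₀ > 0`. Implies the plain leaf
(`ObsStiffnessSeqCeilingAt.ceilingAt`) and is discharged by the SAME certified rows (they hold along every sequence of sides).
[cite: ScalapinoWhiteZhang1993, §II] -/
def ObsStiffnessSeqCeilingAt (tp U n : ℝ) (c : ℚ) : Prop :=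
  ∀ (ρs θ₀ : ℝ), 0 < ρs → 0 < θ₀ → ∀ Ls : ℕ → ℕ, Tendsto Ls atTop atTop →
    (∀ (j : ℕ) [NeZero (Ls j)] (θ : ℝ), |θ| ≤ θ₀ →
      ρs * θ ^ 2 ≤ fluxEnergyTT' (Ls j) tp U (1 - n) θ - fluxEnergyTT' (Ls j) tp U (1 - n) 0) →
    ρs ≤ ((c : ℚ) : ℝ)

/-- Robust ⇒ plain: a uniform flux stiffness along all even sides `L ≥ L₀` is one along the sequence `L_j = 2(L₀ + j + 1)`.
[cite: ScalapinoWhiteZhang1993, §II] -/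
theorem ObsStiffnessSeqCeilingAt.ceilingAt {tp U n : ℝ} {c : ℚ} (h : ObsStiffnessSeqCeilingAt tp U n c) :
    ObsStiffnessCeilingAt tp U n c := by
  intro ρs θ₀ hρs hθ₀ L₀ hst
  refine h ρs θ₀ hρs hθ₀ (fun j => 2 * (L₀ + j + 1))
    (tendsto_atTop_mono (fun j : ℕ => (by omega : j ≤ 2 * (L₀ + j + 1))) tendsto_id) ?_
  intro j _ θ hθ
  haveI : NeZero (2 * (L₀ + j + 1)) := ⟨by omega⟩
  exact hst (2 * (L₀ + j + 1)) (by omega) (even_two_mul _) θ hθ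

/-- **The "frequently" reading of the robust leaf**: if the flux inequality with constant `ρ_s > 0` (scale `θ₀ > 0`) holds at
sides `L` that are merely UNBOUNDED (frequently in `L`), then already `ρ_s ≤ c`. [cite: ScalapinoWhiteZhang1993, §II] -/
theorem ObsStiffnessSeqCeilingAt.le_of_frequently {tp U n : ℝ} {c : ℚ} (h : ObsStiffnessSeqCeilingAt tp U n c)
    {ρs θ₀ : ℝ} (hρs : 0 < ρs) (hθ₀ : 0 < θ₀)
    (hfreq : ∃ᶠ L in atTop, ∀ [NeZero L], ∀ θ : ℝ, |θ| ≤ θ₀ →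
      ρs * θ ^ 2 ≤ fluxEnergyTT' L tp U (1 - n) θ - fluxEnergyTT' L tp U (1 - n) 0) :
    ρs ≤ ((c : ℚ) : ℝ) := by
  obtain ⟨φ, hφ, hP⟩ := Filter.extraction_of_frequently_atTop hfreq
  exact h ρs θ₀ hρs hθ₀ φ hφ.tendsto_atTop fun j => @hP j

/-- Monotone transport (plain leaf). -/
theorem ObsStiffnessCeilingAt.mono {tp U n : ℝ} {c c' : ℚ} (h : ObsStiffnessCeilingAt tp U n c) (hcc : c ≤ c') :
    ObsStiffnessCeilingAt tp U n c' :=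
  fun ρs θ₀ hρs hθ₀ L₀ hst => (h ρs θ₀ hρs hθ₀ L₀ hst).trans (by exact_mod_cast hcc)

/-- Monotone transport (robust leaf). -/
theorem ObsStiffnessSeqCeilingAt.mono {tp U n : ℝ} {c c' : ℚ} (h : ObsStiffnessSeqCeilingAt tp U n c) (hcc : c ≤ c') :
    ObsStiffnessSeqCeilingAt tp U n c' :=
  fun ρs θ₀ hρs hθ₀ Ls hLs hst => (h ρs θ₀ hρs hθ₀ Ls hLs hst).trans (by exact_mod_cast hcc)

/-! ## §2 At `(U, n) = (8, 7/8)` the anchor leaves ARE the M3 leaves -/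

/-- At `(8, 7/8, t′)`: `ObsStiffnessCeilingAt tp 8 (7/8) c ↔ M3ObsStiffnessCeilingAt tp c`. [cite: ScalapinoWhiteZhang1993, §II] -/
theorem obsStiffnessCeilingAt_m3_iff (tp : ℝ) (c : ℚ) :
    ObsStiffnessCeilingAt tp 8 (7 / 8) c ↔ M3ObsStiffnessCeilingAt tp c := by
  have h : (1 - 7 / 8 : ℝ) = 1 / 8 := by norm_num
  simp only [ObsStiffnessCeilingAt, M3ObsStiffnessCeilingAt, h]

/-- At `(8, 7/8, 0)`: `ObsStiffnessCeilingAt 0 8 (7/8) c ↔ M3ObsStiffnessCeilingAt_tp0 c` (the registry's `t′ = 0` leaf shape).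
[cite: ScalapinoWhiteZhang1993, §II] -/
theorem obsStiffnessCeilingAt_m3_tp0_iff (c : ℚ) :
    ObsStiffnessCeilingAt 0 8 (7 / 8) c ↔ M3ObsStiffnessCeilingAt_tp0 c :=
  (obsStiffnessCeilingAt_m3_iff 0 c).trans (M3ObsStiffnessCeilingAt_zero_iff c)

/-- Robust leaf at `(8, 7/8, t′)` ⇒ the M3 leaf `M3ObsStiffnessCeilingAt tp c`. -/
theorem ObsStiffnessSeqCeilingAt.m3 {tp : ℝ} {c : ℚ} (h : ObsStiffnessSeqCeilingAt tp 8 (7 / 8) c) :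
    M3ObsStiffnessCeilingAt tp c :=
  (obsStiffnessCeilingAt_m3_iff tp c).1 h.ceilingAt

/-- Robust leaf at `(8, 7/8, 0)` ⇒ the registry's `t′ = 0` leaf `M3ObsStiffnessCeilingAt_tp0 c`. -/
theorem ObsStiffnessSeqCeilingAt.m3_tp0 {c : ℚ} (h : ObsStiffnessSeqCeilingAt 0 8 (7 / 8) c) :
    M3ObsStiffnessCeilingAt_tp0 c :=
  (obsStiffnessCeilingAt_m3_tp0_iff c).1 h.ceilingAt

/-- Robust leaf at `(8, 7/8, 0)` with `c ≤` the chord literal ⇒ the NAMED leaf `M3ObsStiffnessCeiling_tp0`. -/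
theorem ObsStiffnessSeqCeilingAt.m3_named {c : ℚ} (h : ObsStiffnessSeqCeilingAt 0 8 (7 / 8) c)
    (hc : c ≤ 906213886029816052260099 / 2 ^ 81) : M3ObsStiffnessCeiling_tp0 :=
  M3ObsStiffnessCeilingAt_tp0_mono h.m3_tp0 hc

/-! ## §3 Dischargers from certified WINDOW rows (any anchor) -/

/-- **Leaf discharger from a certified odd-moment / `t–t′` kinetic orbit row at `(U, n, t′)`.** If the registry-shaped row
`SquareTTPrimeCorrOrbitLowerRow tp U n u r S (box 2 7) (−oddMomentObsTT tp U λ)` holds (`S ⊆ D₄` nonempty, `0 ≤ n ≤ 2`) and the cap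
`e₀(U, n, t′) ≤ u` is certified, then `ObsStiffnessSeqCeilingAt tp U n c` for every `c ≥ −r`. [cite: ScalapinoWhiteZhang1993, §II] -/
theorem ObsStiffnessSeqCeilingAt_of_oddMomentTT_orbitLowerRow (tp U n lam : ℝ) {u r : ℚ}
    (S : Finset (DihedralGroup 4)) (hS : S.Nonempty) (hn0 : 0 ≤ n) (hn2 : n ≤ 2)
    (hrow : SquareTTPrimeCorrOrbitLowerRow tp U n u r S (box 2 7) (-oddMomentObsTT tp U lam))
    (hu : energyDensityTT' 1 tp U n ≤ ((u : ℚ) : ℝ)) (c : ℚ) (hc : -r ≤ c) :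
    ObsStiffnessSeqCeilingAt tp U n c := by
  intro ρs θ₀ _ hθ₀ Ls hLs hst
  have hrow' : SquareTTPrimeCorrOrbitLowerRow tp U (1 - (1 - n)) u r S (box 2 7) (-oddMomentObsTT tp U lam) := by
    rw [sub_sub_cancel]; exact hrow
  have hu' : energyDensityTT' 1 tp U (1 - (1 - n)) ≤ ((u : ℚ) : ℝ) := by rw [sub_sub_cancel]; exact hu
  exact (fluxStiffness_le_of_oddMomentTT_orbitLowerRow_neg_seq tp lam S hS (by linarith) (by linarith) hθ₀ hLs hst
    hrow' hu').trans (by exact_mod_cast hc)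

/-- The same with `S = D₄` (the form the cell's node files state). [cite: ScalapinoWhiteZhang1993, §II] -/
theorem ObsStiffnessSeqCeilingAt_of_oddMomentTT_orbitLowerRow_univ (tp U n lam : ℝ) {u r : ℚ} (hn0 : 0 ≤ n) (hn2 : n ≤ 2)
    (hrow : SquareTTPrimeCorrOrbitLowerRow tp U n u r Finset.univ (box 2 7) (-oddMomentObsTT tp U lam))
    (hu : energyDensityTT' 1 tp U n ≤ ((u : ℚ) : ℝ)) (c : ℚ) (hc : -r ≤ c) :
    ObsStiffnessSeqCeilingAt tp U n c :=
  ObsStiffnessSeqCeilingAt_of_oddMomentTT_orbitLowerRow tp U n lam Finset.univ Finset.univ_nonempty hn0 hn2 hrow hu c hc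

/-- **Leaf discharger from a certified kinetic-word orbit row (`t′ = 0`, the `kinlo` shape) at `(U, n, 0)`.** If
`SquareTTPrimeCorrOrbitLowerRow 0 U n u q univ kinWindow kinWord` holds (`n ≤ 2`) and the cap `e₀(U, n, 0) ≤ u` is certified, then
`ObsStiffnessSeqCeilingAt 0 U n c` for every `c ≥ −q/4` (f-sum). [cite: ScalapinoWhiteZhang1993, §II] -/
theorem ObsStiffnessSeqCeilingAt_tp0_of_kinWord_orbitLowerRow {U n : ℝ} {u q : ℚ} (hn2 : n ≤ 2)
    (hrow : SquareTTPrimeCorrOrbitLowerRow 0 U n u q Finset.univ kinWindow kinWord)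
    (hu : energyDensityTT' 1 0 U n ≤ ((u : ℚ) : ℝ)) (c : ℚ) (hc : -q / 4 ≤ c) :
    ObsStiffnessSeqCeilingAt 0 U n c := by
  intro ρs θ₀ hρs hθ₀ Ls hLs hst
  have hst' : ∀ (j : ℕ) [NeZero (Ls j)] (θ : ℝ), |θ| ≤ θ₀ →
      ρs * θ ^ 2 ≤ fluxEnergy (Ls j) U (1 - n) θ - fluxEnergy (Ls j) U (1 - n) 0 :=
    fun j _ θ hθ => by simpa only [fluxEnergyTT'_tPrime_zero] using hst j θ hθ
  have hrow' : SquareTTPrimeCorrOrbitLowerRow 0 U (1 - (1 - n)) u q Finset.univ kinWindow kinWord := by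
    rw [sub_sub_cancel]; exact hrow
  have hu' : energyDensityTT' 1 0 U (1 - (1 - n)) ≤ ((u : ℚ) : ℝ) := by rw [sub_sub_cancel]; exact hu
  have hc' : -((q : ℚ) : ℝ) / 4 ≤ ((c : ℚ) : ℝ) := by exact_mod_cast hc
  exact (fluxStiffness_le_of_kinWord_orbitLowerRow_seq (by linarith) hρs hθ₀ hLs hst' hrow' hu').trans hc'

/-- **Leaf discharger from a kinetic FLOOR on the torus-limit class (`t′ = 0`)** — the hypothesis shape of the registry's kinetic
rows at `(U, n, 0)` (`K ≤ k(ω)` for every torus limit of unit `(rectN n L, S^z = 0)`-sector ground states of `hubbardTorusTT' L 1 0 U`):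
`ObsStiffnessSeqCeilingAt 0 U n c` for every `c ≥ −K/4`. [cite: ScalapinoWhiteZhang1993, §II] -/
theorem ObsStiffnessSeqCeilingAt_tp0_of_kineticDensity_ge {U n : ℝ} (hn2 : n ≤ 2) (K : ℝ) (c : ℚ)
    (hKc : -K / 4 ≤ ((c : ℚ) : ℝ))
    (hrow : ∀ (ω : InfVolFermionState 2) (Ls : ℕ → ℕ) (ψ : ∀ L, Fock (Orb (FermionTorus 2 L))),
      Tendsto Ls atTop atTop →
      (∀ j, IsGroundStateInSector (hubbardTorusTT' (Ls j) 1 0 U) (rectN n (Ls j)) 0 (ψ (Ls j))) →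
      (∀ j, star (ψ (Ls j)) ⬝ᵥ ψ (Ls j) = 1) → ω.IsTorusLimitOf ψ Ls →
      K ≤ ∑ i : Fin 2, -(1 : ℝ) * ∑ σ : Fin 2,
        ((ω.expect {0, 0 + unitVec i}
            ((cAt 0 (mem_insert_self _ _) σ)ᴴ * cAt (0 + unitVec i) (mem_insert_of_mem (mem_singleton_self _)) σ)).re +
          (ω.expect {0, 0 + unitVec i}
            ((cAt (0 + unitVec i) (mem_insert_of_mem (mem_singleton_self _)) σ)ᴴ * cAt 0 (mem_insert_self _ _) σ)).re)) :
    ObsStiffnessSeqCeilingAt 0 U n c := by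
  intro ρs θ₀ hρs hθ₀ Ls hLs hst
  have hst' : ∀ (j : ℕ) [NeZero (Ls j)] (θ : ℝ), |θ| ≤ θ₀ →
      ρs * θ ^ 2 ≤ fluxEnergy (Ls j) U (1 - n) θ - fluxEnergy (Ls j) U (1 - n) 0 :=
    fun j _ θ hθ => by simpa only [fluxEnergyTT'_tPrime_zero] using hst j θ hθ
  refine (fluxStiffness_le_of_torusLimit_kineticDensity_ge_TT'zero_seq (δ := 1 - n) (by linarith) hρs hθ₀ hLs hst'
    fun ω Ms ψ hMs hψ h1 hω => hrow ω Ms ψ hMs (fun j => ?_) h1 hω).trans hKc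
  simpa only [sub_sub_cancel] using hψ j

/-! ## §4 Dischargers from AFFINE (re-priceable) rows under ANY certified window — the fast layer in leaf form -/

/-- **Re-priced robust leaf from an affine odd-moment / `t–t′` kinetic row at `(U, n, t′)`.** If the certificate's AFFINE orbit row
`SquareTTPrimeCorrAffineOrbitLowerRow tp U n q hi lo κhi κlo S (box 2 7) (−oddMomentObsTT tp U λ)` holds (`S` nonempty, `κhi, κlo ≥ 0`,
`0 ≤ n ≤ 2`) and ANY window `lo' ≤ e₀(U, n, t′) ≤ hi'` is certified, then `ObsStiffnessSeqCeilingAt tp U n c` for every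
`c ≥ −reprice q hi lo κhi κlo hi' lo' = −q − κhi(hi − hi') − κlo(lo' − lo)`. [cite: BoydVandenberghe2004, §5.6] -/
theorem ObsStiffnessSeqCeilingAt_of_affineOddMomentTT_orbitRow (tp U n lam : ℝ) {q hi lo κhi κlo lo' hi' : ℚ}
    (S : Finset (DihedralGroup 4)) (hS : S.Nonempty) (hn0 : 0 ≤ n) (hn2 : n ≤ 2)
    (hrow : SquareTTPrimeCorrAffineOrbitLowerRow tp U n q hi lo κhi κlo S (box 2 7) (-oddMomentObsTT tp U lam))
    (hκhi : 0 ≤ κhi) (hκlo : 0 ≤ κlo) (hlo' : ((lo' : ℚ) : ℝ) ≤ energyDensityTT' 1 tp U n)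
    (hhi' : energyDensityTT' 1 tp U n ≤ ((hi' : ℚ) : ℝ)) (c : ℚ) (hc : -reprice q hi lo κhi κlo hi' lo' ≤ c) :
    ObsStiffnessSeqCeilingAt tp U n c :=
  ObsStiffnessSeqCeilingAt_of_oddMomentTT_orbitLowerRow tp U n lam S hS hn0 hn2
    (hrow.orbitLowerRow_of_floor hκhi hκlo hlo') hhi' c hc

/-- The affine fast layer in leaf form: under the window `[lo', hi']` the robust leaf holds AT the re-priced constant; a better cap
`hi'' ≤ hi'` lowers it by exactly `κhi·(hi' − hi'')` (`reprice_stiffnessLeaf_cap_gain`). [cite: BoydVandenberghe2004, §5.6] -/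
theorem ObsStiffnessSeqCeilingAt_reprice_of_affineOddMomentTT_orbitRow_univ (tp U n lam : ℝ) {q hi lo κhi κlo lo' hi' : ℚ}
    (hn0 : 0 ≤ n) (hn2 : n ≤ 2)
    (hrow : SquareTTPrimeCorrAffineOrbitLowerRow tp U n q hi lo κhi κlo Finset.univ (box 2 7) (-oddMomentObsTT tp U lam))
    (hκhi : 0 ≤ κhi) (hκlo : 0 ≤ κlo) (hlo' : ((lo' : ℚ) : ℝ) ≤ energyDensityTT' 1 tp U n)
    (hhi' : energyDensityTT' 1 tp U n ≤ ((hi' : ℚ) : ℝ)) :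
    ObsStiffnessSeqCeilingAt tp U n (-reprice q hi lo κhi κlo hi' lo') :=
  ObsStiffnessSeqCeilingAt_of_affineOddMomentTT_orbitRow tp U n lam Finset.univ Finset.univ_nonempty hn0 hn2 hrow hκhi hκlo
    hlo' hhi' _ le_rfl

/-- **Re-priced robust f-sum leaf from an affine KINETIC-word row (`t′ = 0`) at `(U, n, 0)`**: with `q' = reprice q hi lo κhi κlo hi' lo'`
the re-priced kinetic floor under ANY certified window `lo' ≤ e₀ ≤ hi'`, `ObsStiffnessSeqCeilingAt 0 U n c` for every `c ≥ −q'/4`.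
[cite: BoydVandenberghe2004, §5.6] -/
theorem ObsStiffnessSeqCeilingAt_tp0_of_affineKinWord_orbitRow {U n : ℝ} {q hi lo κhi κlo lo' hi' : ℚ} (hn2 : n ≤ 2)
    (hrow : SquareTTPrimeCorrAffineOrbitLowerRow 0 U n q hi lo κhi κlo Finset.univ kinWindow kinWord)
    (hκhi : 0 ≤ κhi) (hκlo : 0 ≤ κlo) (hlo' : ((lo' : ℚ) : ℝ) ≤ energyDensityTT' 1 0 U n)
    (hhi' : energyDensityTT' 1 0 U n ≤ ((hi' : ℚ) : ℝ)) (c : ℚ) (hc : -reprice q hi lo κhi κlo hi' lo' / 4 ≤ c) :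
    ObsStiffnessSeqCeilingAt 0 U n c :=
  ObsStiffnessSeqCeilingAt_tp0_of_kinWord_orbitLowerRow hn2 (hrow.orbitLowerRow_of_floor hκhi hκlo hlo') hhi' c hc

/-! ## §5 U-ray transport in leaf form (`t′ = 0`): one kinetic ceiling at `(U₀, n, 0)` serves every `U ≥ U₀` -/

/-- **Robust f-sum leaf on the whole half-line `U ≥ U₀` from ONE certified kinetic ceiling at the anchor `(U₀, n, 0)`**
(`0 ≤ U₀ ≤ U`, `0 ≤ n < 2`): if `−k(ω) ≤ X` for every torus limit `ω` of unit `(rectN n L, S^z = 0)`-sector ground states of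
`hubbardTorusTT' L 1 0 U₀`, then `ObsStiffnessSeqCeilingAt 0 U n c` for every `c ≥ X/4` — the kinetic energy `⟨−T⟩` is non-increasing in
`U` on the torus-limit ground-state classes (`forall_torusLimit_negKinetic_le_of_le_coupling`). Nothing transports in `n` or `t′`.
[cite: Griffiths1966, §II] -/
theorem ObsStiffnessSeqCeilingAt_tp0_on_ray_of_forall_negKinetic_le {U₀ U n : ℝ} (hU₀ : 0 ≤ U₀) (hU : U₀ ≤ U)
    (hn0 : 0 ≤ n) (hn2 : n < 2) {X : ℝ}
    (hX : ∀ (ω : InfVolFermionState 2) (Ls : ℕ → ℕ) (ψ : ∀ L, Fock (Orb (FermionTorus 2 L))),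
      Tendsto Ls atTop atTop →
      (∀ j, IsGroundStateInSector (hubbardTorusTT' (Ls j) 1 0 U₀) (rectN n (Ls j)) 0 (ψ (Ls j))) →
      (∀ j, star (ψ (Ls j)) ⬝ᵥ ψ (Ls j) = 1) → ω.IsTorusLimitOf ψ Ls →
      -(∑ i : Fin 2, -(1 : ℝ) * ∑ σ : Fin 2,
          ((ω.expect {0, 0 + unitVec i}
              ((cAt 0 (mem_insert_self _ _) σ)ᴴ * cAt (0 + unitVec i) (mem_insert_of_mem (mem_singleton_self _)) σ)).re +
            (ω.expect {0, 0 + unitVec i}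
              ((cAt (0 + unitVec i) (mem_insert_of_mem (mem_singleton_self _)) σ)ᴴ * cAt 0 (mem_insert_self _ _) σ)).re)) ≤ X)
    (c : ℚ) (hc : X / 4 ≤ ((c : ℚ) : ℝ)) :
    ObsStiffnessSeqCeilingAt 0 U n c := by
  have hXU := forall_torusLimit_negKinetic_le_of_le_coupling hU₀ hU hn0 hn2 hX
  refine ObsStiffnessSeqCeilingAt_tp0_of_kineticDensity_ge hn2.le (-X) c (by linarith) fun ω Ls ψ hLs hψ h1 hω => ?_
  have h := hXU ω Ls ψ hLs hψ h1 hω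
  linarith

/-- **Robust f-sum leaf on the half-line `U ≥ U₀` from ONE certified `kinWord` orbit row at `(U₀, n, 0)`** (the `kinlo` node shape) plus
its cap `e₀(U₀, n, 0) ≤ u`: `ObsStiffnessSeqCeilingAt 0 U n c` for every `U ≥ U₀ ≥ 0` and every `c ≥ −q/4`. [cite: Griffiths1966, §II] -/
theorem ObsStiffnessSeqCeilingAt_tp0_on_ray_of_kinWord_orbitLowerRow {U₀ U n : ℝ} {u q : ℚ} (hU₀ : 0 ≤ U₀) (hU : U₀ ≤ U)
    (hn0 : 0 ≤ n) (hn2 : n < 2)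
    (hrow : SquareTTPrimeCorrOrbitLowerRow 0 U₀ n u q Finset.univ kinWindow kinWord)
    (hu : energyDensityTT' 1 0 U₀ n ≤ ((u : ℚ) : ℝ)) (c : ℚ) (hc : -q / 4 ≤ c) :
    ObsStiffnessSeqCeilingAt 0 U n c := by
  have hc' : -((q : ℚ) : ℝ) / 4 ≤ ((c : ℚ) : ℝ) := by exact_mod_cast hc
  refine ObsStiffnessSeqCeilingAt_tp0_on_ray_of_forall_negKinetic_le hU₀ hU hn0 hn2
    (X := -((q : ℚ) : ℝ)) (fun ω Ls ψ hLs hψ h1 hω => ?_) c (by linarith)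
  exact squareTTPrimeCorrOrbitLowerRow_kinWord_negKinetic_le hrow ω Ls ψ hLs hψ h1 hω hu

end Summit.Ventures.CertifiedManyBodySolver.Observables

end
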